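import Summits.BirchSwinnertonDyer.BirchSwinnertonDyer.Theorems.BiquadraticEisensteinDescentHeegnerTwistCouplingInSupplySqrtTwoDualFifteen
import Summits.BirchSwinnertonDyer.BirchSwinnertonDyer.Theorems.BiquadraticEisensteinDescentHeegnerTwistCouplingInSupplySqrtTwoWindow
import Literature.NumberTheory.EllipticCurves.ModularityVersionApProofs
import Literature.NumberTheory.EllipticCurves.Rank1Residual.Predicates
import HarnessLib

set_option linter.dupNamespace false -- `Summit.BirchSwinnertonDyer.BirchSwinnertonDyer.Theorems.…` (summit = sub)
set_option autoImplicit false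

/-!
# Crux `HeegnerTwistCouplingInSupply` (stmt-BirchSwinnertonDyer-21381) RESTRICTED TO THE `j = 8000` FAMILIES `{B_p}`, `{B_{−2p}}`
# (`p` prime `≡ 15 (mod 16)`; and `p ≡ 5 (mod 8)` inside the window) — the crux body with `W` instantiated

Route `BiquadraticEisensteinDescent` (cell `pub/bsd-wall`, width seat `bsd-wall-cm-bed-w2` g13; `--supports` 21381, helper). Bookkeeping twin of
`…RoundingPinCruxOnFamily` (the congruent families `E_n`, `E_{2n}`) for the `j = 8000` corner: `B_p = ⟨0, 4p, 0, 2p², 0⟩` and its isogenous member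
`B_{−2p} = ⟨0, −8p, 0, 8p², 0⟩` (CM by `ℤ[√−2]`). The corner theorems `…SqrtTwoCornerFifteen.cruxOnBpCornerFifteen_of_two_facts` and
`…SqrtTwoDualFifteen.cruxOnBdualCornerFifteen_of_two_facts` (w2 g12: EVERY prime `p ≡ 15 (mod 16)`), and `…SqrtTwoWindow.cruxOnBpCornerWindow_of_two_facts` /
`cruxOnBdualCornerWindow_of_two_facts` (this seat: `p ≡ 5 (mod 8)`, `p ≥ 2700`, a `(5,−)`-partner `q₀² ≤ 9p`) give the crux CONCLUSION; the
body of the route decl quantifies over a second prime `p'` with `5 ≤ p'`, `CMInert W p'`, `¬ Good W p'` — and for `W ∈ {B_p, B_{−2p}}` the bad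
primes are `2` and `p` (`eq_two_or_eq_of_prime_dvd_conductorNorm_B/_Bdual` + `dvd_conductorNorm_iff_not_hasGoodReductionAtPrime`), so `p' = p`.

* `eq_of_not_good_B` / `eq_of_not_good_Bdual` — `¬ Good W p'`, `5 ≤ p'` ⇒ `p' = p`;
* ★★ `heegnerTwistCouplingInSupply_of_eq_B_fifteen` / `…_of_eq_Bdual_fifteen` — the crux body for every `W` with `∃ p prime, p % 16 = 15, W = B_p`
  (resp. `W = B_{−2p}`), modulo Burungale–Tian + Deuring–Hecke ONLY;
* ★ `heegnerTwistCouplingInSupply_of_eq_B_window` / `…_of_eq_Bdual_window` — the crux body for `W = B_p` (resp. `B_{−2p}`), `p ≡ 5 (mod 8)`, `p ≥ 2700`,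
  under the extra window hypothesis `∃ q₀ prime ≡ 5 (8), (q₀/p) = −1, q₀² ≤ 9p`, same two named facts.

HONEST FRAMING: sub-corner families of measure zero in «all CM `W` of analytic rank one»; `p ≡ 7 (mod 16)` has no 2-descent cell (w2 g12 N2); the
crux (residual C⁺) is NOT closed; BSD is not proved by any of this. THEOREMS ONLY; the Theses module is not imported. Supports stmt-BirchSwinnertonDyer-21381.
-/

noncomputable section

open scoped Classical

namespace Summit.BirchSwinnertonDyer.BirchSwinnertonDyer.Theorems.BiquadraticEisensteinDescentHeegnerTwistCouplingInSupplySqrtTwoCruxOnFamily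

open _root_.WeierstrassCurve Literature.NumberTheory.EllipticCurves Literature.NumberTheory.EllipticCurves.Rank1Residual
open Summit.BirchSwinnertonDyer.BirchSwinnertonDyer.Theorems.BiquadraticEisensteinDescentHeegnerTwistCouplingInSupplySqrtTwoCorner
  (eq_two_or_eq_of_prime_dvd_conductorNorm_B)
open Summit.BirchSwinnertonDyer.BirchSwinnertonDyer.Theorems.BiquadraticEisensteinDescentHeegnerTwistCouplingInSupplySqrtTwoDual
  (eq_two_or_eq_of_prime_dvd_conductorNorm_Bdual)
open Summit.BirchSwinnertonDyer.BirchSwinnertonDyer.Theorems.BiquadraticEisensteinDescentHeegnerTwistCouplingInSupplySqrtTwoCornerFifteen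
  (cruxOnBpCornerFifteen_of_two_facts)
open Summit.BirchSwinnertonDyer.BirchSwinnertonDyer.Theorems.BiquadraticEisensteinDescentHeegnerTwistCouplingInSupplySqrtTwoDualFifteen
  (cruxOnBdualCornerFifteen_of_two_facts)
open Summit.BirchSwinnertonDyer.BirchSwinnertonDyer.Theorems.BiquadraticEisensteinDescentHeegnerTwistCouplingInSupplySqrtTwoWindow
  (cruxOnBpCornerWindow_of_two_facts cruxOnBdualCornerWindow_of_two_facts)

/-! ## §1 The bad primes of `B_p`, `B_{−2p}` -/

/-- **The only bad prime `≥ 5` of `B_p` is `p`**: `¬ Good B_p p' ⇔ p' ∣ N(B_p)` and the prime divisors of `N(B_p)` are `2`, `p`.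
[cite: DiamondShurman2005, §8.3 (PDF p. 353)] -/
theorem eq_of_not_good_B {p p' : ℕ} [Fact p'.Prime] [(⟨0, 4 * (p : ℚ), 0, 2 * (p : ℚ) ^ 2, 0⟩ : WeierstrassCurve ℚ).IsElliptic]
    (hp : p.Prime) (h5 : 5 ≤ p') (hbad : ¬ Good (⟨0, 4 * (p : ℚ), 0, 2 * (p : ℚ) ^ 2, 0⟩ : WeierstrassCurve ℚ) p') : p' = p := by
  have hp' : p'.Prime := Fact.out
  have hdvd := ((⟨0, 4 * (p : ℚ), 0, 2 * (p : ℚ) ^ 2, 0⟩ : WeierstrassCurve ℚ).dvd_conductorNorm_iff_not_hasGoodReductionAtPrime p').mpr hbad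
  rcases eq_two_or_eq_of_prime_dvd_conductorNorm_B hp hp' hdvd with h | h
  · omega
  · exact h

/-- **The only bad prime `≥ 5` of `B_{−2p}` is `p`.** [cite: DiamondShurman2005, §8.3 (PDF p. 353)] -/
theorem eq_of_not_good_Bdual {p p' : ℕ} [Fact p'.Prime] [(⟨0, -8 * (p : ℚ), 0, 8 * (p : ℚ) ^ 2, 0⟩ : WeierstrassCurve ℚ).IsElliptic]
    (hp : p.Prime) (h5 : 5 ≤ p') (hbad : ¬ Good (⟨0, -8 * (p : ℚ), 0, 8 * (p : ℚ) ^ 2, 0⟩ : WeierstrassCurve ℚ) p') : p' = p := by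
  have hp' : p'.Prime := Fact.out
  have hdvd := ((⟨0, -8 * (p : ℚ), 0, 8 * (p : ℚ) ^ 2, 0⟩ : WeierstrassCurve ℚ).dvd_conductorNorm_iff_not_hasGoodReductionAtPrime p').mpr hbad
  rcases eq_two_or_eq_of_prime_dvd_conductorNorm_Bdual hp hp' hdvd with h | h
  · omega
  · exact h

/-! ## §2 ★★ The crux body on `{B_p}`, `{B_{−2p}}`, `p ≡ 15 (mod 16)` -/

/-- ★★ **THE CRUX BODY FOR EVERY `W = B_p`, `p` PRIME `≡ 15 (mod 16)`, TWO NAMED FACTS** (Burungale–Tian + Deuring–Hecke): the body of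
`HeegnerTwistCouplingInSupply` with the single extra hypothesis `∃ p, p.Prime ∧ p % 16 = 15 ∧ W = B_p` (`¬ Good ∧ 5 ≤ p'` force `p' = p`; then
`cruxOnBpCornerFifteen_of_two_facts`). [cite: BurungaleTian2026, Thm. 1.1] [cite: SilvermanAEC2009, Prop. X.4.9 and Thm. X.4.2(a)] -/
theorem heegnerTwistCouplingInSupply_of_eq_B_fifteen (hBT : burungaleTian_analyticRank_eq_zero_of_selmerCorank_eq_zero_of_hasCM)
    (hH : hasEntireLFunction_of_j_mem_maximalCMJInvariants) :
    ∀ (W : WeierstrassCurve ℚ) [W.IsElliptic] [W.IsGloballyMinimal] (p' : ℕ) [Fact p'.Prime] [NeZero (W.conductorNorm ℤ)],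
      (∃ p : ℕ, p.Prime ∧ p % 16 = 15 ∧ W = ⟨0, 4 * (p : ℚ), 0, 2 * (p : ℚ) ^ 2, 0⟩) →
      W.HasCM → W.analyticRank = 1 → 5 ≤ p' → CMInert W p' → ¬ Good W p' →
      (∀ B : ℕ, ∃ (K : Type) (_ : Field K) (_ : NumberField K), IsImaginaryQuadratic K ∧ B < (NumberField.discr K).natAbs ∧
        4 < (NumberField.discr K).natAbs ∧ SatisfiesHeegnerHypothesis (W.conductorNorm ℤ) K ∧ ¬ p' ∣ NumberField.classNumber K) →
      ∃ (K : Type) (_ : Field K) (_ : NumberField K),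
        IsImaginaryQuadratic K ∧ 4 < (NumberField.discr K).natAbs ∧
        SatisfiesHeegnerHypothesis (W.conductorNorm ℤ) K ∧
        (W.quadraticTwist (NumberField.discr K : ℚ)).entireLFunction 1 ≠ 0 ∧ ¬ p' ∣ NumberField.classNumber K := by
  intro W _ _ p' hpF _ hW _ _ h5 _ hbad _
  obtain ⟨p, hp, hp16, rfl⟩ := hW
  obtain rfl := eq_of_not_good_B hp h5 hbad
  obtain ⟨K, iF, iN, hK, h4, hH', hL, -, hndvd⟩ := cruxOnBpCornerFifteen_of_two_facts hBT hH p' hp16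
  exact ⟨K, iF, iN, hK, h4, hH', hL, hndvd⟩

/-- ★★ **THE CRUX BODY FOR EVERY `W = B_{−2p}`, `p` PRIME `≡ 15 (mod 16)`, TWO NAMED FACTS** (via `cruxOnBdualCornerFifteen_of_two_facts`).
[cite: BurungaleTian2026, Thm. 1.1] [cite: SilvermanAEC2009, Prop. X.4.9 and Thm. X.4.2(a)] -/
theorem heegnerTwistCouplingInSupply_of_eq_Bdual_fifteen (hBT : burungaleTian_analyticRank_eq_zero_of_selmerCorank_eq_zero_of_hasCM)
    (hH : hasEntireLFunction_of_j_mem_maximalCMJInvariants) :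
    ∀ (W : WeierstrassCurve ℚ) [W.IsElliptic] [W.IsGloballyMinimal] (p' : ℕ) [Fact p'.Prime] [NeZero (W.conductorNorm ℤ)],
      (∃ p : ℕ, p.Prime ∧ p % 16 = 15 ∧ W = ⟨0, -8 * (p : ℚ), 0, 8 * (p : ℚ) ^ 2, 0⟩) →
      W.HasCM → W.analyticRank = 1 → 5 ≤ p' → CMInert W p' → ¬ Good W p' →
      (∀ B : ℕ, ∃ (K : Type) (_ : Field K) (_ : NumberField K), IsImaginaryQuadratic K ∧ B < (NumberField.discr K).natAbs ∧
        4 < (NumberField.discr K).natAbs ∧ SatisfiesHeegnerHypothesis (W.conductorNorm ℤ) K ∧ ¬ p' ∣ NumberField.classNumber K) →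
      ∃ (K : Type) (_ : Field K) (_ : NumberField K),
        IsImaginaryQuadratic K ∧ 4 < (NumberField.discr K).natAbs ∧
        SatisfiesHeegnerHypothesis (W.conductorNorm ℤ) K ∧
        (W.quadraticTwist (NumberField.discr K : ℚ)).entireLFunction 1 ≠ 0 ∧ ¬ p' ∣ NumberField.classNumber K := by
  intro W _ _ p' hpF _ hW _ _ h5 _ hbad _
  obtain ⟨p, hp, hp16, rfl⟩ := hW
  obtain rfl := eq_of_not_good_Bdual hp h5 hbad
  obtain ⟨K, iF, iN, hK, h4, hH', hL, -, hndvd⟩ := cruxOnBdualCornerFifteen_of_two_facts hBT hH p' hp16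
  exact ⟨K, iF, iN, hK, h4, hH', hL, hndvd⟩

/-! ## §3 ★ The crux body on `{B_p}`, `{B_{−2p}}`, `p ≡ 5 (mod 8)`, inside the window -/

/-- ★ **THE CRUX BODY FOR `W = B_p`, `p` PRIME `≡ 5 (mod 8)`, `p ≥ 2700`, GIVEN A WINDOW PARTNER** (a prime `q₀ ≡ 5 (mod 8)` with `(q₀/p) = −1`,
`q₀² ≤ 9p`), two named facts (via `cruxOnBpCornerWindow_of_two_facts`). [cite: BurungaleTian2026, Thm. 1.1] [cite: Oesterle1988Gauss, II §3 Proposition p. 57 (27)] -/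
theorem heegnerTwistCouplingInSupply_of_eq_B_window (hBT : burungaleTian_analyticRank_eq_zero_of_selmerCorank_eq_zero_of_hasCM)
    (hH : hasEntireLFunction_of_j_mem_maximalCMJInvariants) :
    ∀ (W : WeierstrassCurve ℚ) [W.IsElliptic] [W.IsGloballyMinimal] (p' : ℕ) [Fact p'.Prime] [NeZero (W.conductorNorm ℤ)],
      (∃ p : ℕ, p.Prime ∧ p % 8 = 5 ∧ 2700 ≤ p ∧ W = ⟨0, 4 * (p : ℚ), 0, 2 * (p : ℚ) ^ 2, 0⟩ ∧
        ∃ q₀ : ℕ, q₀.Prime ∧ q₀ % 8 = 5 ∧ jacobiSym (q₀ : ℤ) p = -1 ∧ q₀ * q₀ ≤ 9 * p) →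
      W.HasCM → W.analyticRank = 1 → 5 ≤ p' → CMInert W p' → ¬ Good W p' →
      (∀ B : ℕ, ∃ (K : Type) (_ : Field K) (_ : NumberField K), IsImaginaryQuadratic K ∧ B < (NumberField.discr K).natAbs ∧
        4 < (NumberField.discr K).natAbs ∧ SatisfiesHeegnerHypothesis (W.conductorNorm ℤ) K ∧ ¬ p' ∣ NumberField.classNumber K) →
      ∃ (K : Type) (_ : Field K) (_ : NumberField K),
        IsImaginaryQuadratic K ∧ 4 < (NumberField.discr K).natAbs ∧
        SatisfiesHeegnerHypothesis (W.conductorNorm ℤ) K ∧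
        (W.quadraticTwist (NumberField.discr K : ℚ)).entireLFunction 1 ≠ 0 ∧ ¬ p' ∣ NumberField.classNumber K := by
  intro W _ _ p' hpF _ hW _ _ h5 _ hbad _
  obtain ⟨p, hp, hp8, h2700, rfl, q₀, hq₀, hq₀8, hJ, hwin⟩ := hW
  obtain rfl := eq_of_not_good_B hp h5 hbad
  obtain ⟨K, iF, iN, hK, h4, hH', hL, -, hndvd⟩ := cruxOnBpCornerWindow_of_two_facts hBT hH p' hp8 h2700 q₀ hq₀ hq₀8 hJ hwin
  exact ⟨K, iF, iN, hK, h4, hH', hL, hndvd⟩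

/-- ★ **THE CRUX BODY FOR `W = B_{−2p}`, `p` PRIME `≡ 5 (mod 8)`, `p ≥ 2700`, GIVEN A WINDOW PARTNER**, two named facts (via
`cruxOnBdualCornerWindow_of_two_facts`). [cite: BurungaleTian2026, Thm. 1.1] [cite: Oesterle1988Gauss, II §3 Proposition p. 57 (27)] -/
theorem heegnerTwistCouplingInSupply_of_eq_Bdual_window (hBT : burungaleTian_analyticRank_eq_zero_of_selmerCorank_eq_zero_of_hasCM)
    (hH : hasEntireLFunction_of_j_mem_maximalCMJInvariants) :
    ∀ (W : WeierstrassCurve ℚ) [W.IsElliptic] [W.IsGloballyMinimal] (p' : ℕ) [Fact p'.Prime] [NeZero (W.conductorNorm ℤ)],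
      (∃ p : ℕ, p.Prime ∧ p % 8 = 5 ∧ 2700 ≤ p ∧ W = ⟨0, -8 * (p : ℚ), 0, 8 * (p : ℚ) ^ 2, 0⟩ ∧
        ∃ q₀ : ℕ, q₀.Prime ∧ q₀ % 8 = 5 ∧ jacobiSym (q₀ : ℤ) p = -1 ∧ q₀ * q₀ ≤ 9 * p) →
      W.HasCM → W.analyticRank = 1 → 5 ≤ p' → CMInert W p' → ¬ Good W p' →
      (∀ B : ℕ, ∃ (K : Type) (_ : Field K) (_ : NumberField K), IsImaginaryQuadratic K ∧ B < (NumberField.discr K).natAbs ∧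
        4 < (NumberField.discr K).natAbs ∧ SatisfiesHeegnerHypothesis (W.conductorNorm ℤ) K ∧ ¬ p' ∣ NumberField.classNumber K) →
      ∃ (K : Type) (_ : Field K) (_ : NumberField K),
        IsImaginaryQuadratic K ∧ 4 < (NumberField.discr K).natAbs ∧
        SatisfiesHeegnerHypothesis (W.conductorNorm ℤ) K ∧
        (W.quadraticTwist (NumberField.discr K : ℚ)).entireLFunction 1 ≠ 0 ∧ ¬ p' ∣ NumberField.classNumber K := by
  intro W _ _ p' hpF _ hW _ _ h5 _ hbad _
  obtain ⟨p, hp, hp8, h2700, rfl, q₀, hq₀, hq₀8, hJ, hwin⟩ := hW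
  obtain rfl := eq_of_not_good_Bdual hp h5 hbad
  obtain ⟨K, iF, iN, hK, h4, hH', hL, -, hndvd⟩ := cruxOnBdualCornerWindow_of_two_facts hBT hH p' hp8 h2700 q₀ hq₀ hq₀8 hJ hwin
  exact ⟨K, iF, iN, hK, h4, hH', hL, hndvd⟩

end Summit.BirchSwinnertonDyer.BirchSwinnertonDyer.Theorems.BiquadraticEisensteinDescentHeegnerTwistCouplingInSupplySqrtTwoCruxOnFamily

end
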